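import Summits.CriticalPhenomena.PercolationContinuityZ3.Theorems.PercNearOneGluingNoHeavyLowerTailKnQuestion8CoefficientwiseCoreClassKernelMixFull
import HarnessLib

/-!
# KB-MIX along a BRIDGE: the one-sided form, the free 'full anti-sum', and the cell bookkeeping

Support file (`--supports stmt-CriticalPhenomena-4575`, closed), prover `prim-cplus-coupling` (gen 36).  No definitions, no notations, no named facts,
no sorries; standard axioms.  Memo `prim-cplus-coupling/A5-COUPLING-gen36.md` §2.  Companions: `…CoreClassKernelMixBridgeAbs` (assembly), `…CoreClassKernelMixBridge` (the graph form: clusters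
across a bridge edge), `…CoreClassKernelMixBridgeMain` (sources of the one-sided form, wrappers, CW-PA over `a′–M–b′` for EVERY middle `M`).

Setting.  Middle graph `E`, terminals `a, b`, `C_v(ω) = openCluster (ends '' ω) v`, `P = C_a ω`, `Q = C_b(E∖ω)`, `S = C_a ω ∪ C_b ω`; test functions `h, k`
and levels `0 ≤ hᵃ, hᵇ ≤ h`, `0 ≤ kᵃ, kᵇ ≤ k`, all monotone.  Two forms (used only as explicit inequalities):
* KB-MIX-FULL(E; a, b):  `Σ_ω h(S)k(S) + Σ_{b ∉ C_a ω, b ∉ C_a(E∖ω)} (hᵃ(P) − hᵇ(Q))(kᵃ(P) − kᵇ(Q)) ≥ 0`  (the wall);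
* ONE-SIDED(E; a, b) ('contact at `a` allowed'):  `Σ_ω h(S)k(S) + Σ_{b ∉ C_a ω} (hᵃ(P) − hᵇ(Q))(kᵃ(P) − kᵇ(Q)) ≥ 0`  (the wall enlarged by the cell
  `{a ∈ C_b(E∖ω), b ∉ C_a ω}`).
BRIDGE: `H = E₁ ⊔ {e} ⊔ E₂`, `e = c₁c₂`, `E₁` and `E₂` vertex-disjoint, `a` on the `E₁` side (`a = c₁` allowed), `b` on the `E₂` side (`b = c₂` allowed).
This file is the ABSTRACT bookkeeping: the two sides enter only through the set-valued maps `P₁ = C_a`, `X₁ = C_{c₁}` (on `2^{E₁}`) and `X₂ = C_{c₂}`,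
`R₂ = C_b` (on `2^{E₂}`); the clusters of `H` are the displayed unions (proved in `…KernelMixBridge`).
* `Coefficientwise.sum_mul_sum_le_sum_one_mul_sum` — Chebyshev / Harris on a sub-powerset: `(Σ F)(Σ G) ≤ N·Σ FG` for monotone `F, G`, `N = #2^E`.
* `Coefficientwise.coreClass_fullAnti` — **the full anti-sum is free**: `Σ_ω h(S)k(S) + Σ_{ALL ω} (hᵃ(C_a ω) − hᵇ(C_b(E∖ω)))(kᵃ(C_a ω) − kᵇ(C_b(E∖ω))) ≥ 0`
  for EVERY graph (both factors are increasing in `ω`; Chebyshev twice).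
* `Coefficientwise.bridgeCell_D1 … bridgeCell_D4` — the four cells; the assembly (THEOREMS A, B) is `…CoreClassKernelMixBridgeAbs`.
Cells (memo §2.2): `e` red & `c₁ ∉ P₁` ← blue supply at the swapped `ω₂`; `e` blue & `c₂ ∉ Q₂` ← red/blue supply at the swapped `ω₂`; `e` red & `c₁ ∈ P₁`
← the `E₂`-hypothesis glued by `P₁`; `e` blue & `c₂ ∈ Q₂` ← ONE-SIDED(E₁; c₁, a) glued by `Q₂` after `ω₁ ↦ E₁∖ω₁`; every supply term is used once.
[cite: KozmaNitzan2024, Questions 8–9 (§5.5 p. 36) (context: the Question-8 pocket covariance programme)]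
-/

namespace Summit.CriticalPhenomena.PercolationContinuityZ3.Theorems

open Finset Literature.Probability.Percolation

namespace Coefficientwise

variable {ι V : Type*}

/-- Chebyshev's sum inequality (Harris in product form) on a sub-powerset: for monotone `F, G : Finset ι → ℝ` (no sign condition),
`(Σ_{ω ⊆ E} F ω)(Σ_{ω ⊆ E} G ω) ≤ (Σ_{ω ⊆ E} 1) · Σ_{ω ⊆ E} F ω G ω`.  Induction on `E` with the one-bit rearrangement.
[cite: KozmaNitzan2024, §5.5 (context only; the inequality is Chebyshev / Harris 1960)] -/
theorem sum_mul_sum_le_sum_one_mul_sum [DecidableEq ι] (E : Finset ι) (F G : Finset ι → ℝ) (hF : Monotone F) (hG : Monotone G) :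
    (∑ ω ∈ E.powerset, F ω) * (∑ ω ∈ E.powerset, G ω) ≤ (∑ _ω ∈ E.powerset, (1 : ℝ)) * ∑ ω ∈ E.powerset, F ω * G ω := by
  induction E using Finset.induction_on generalizing F G with
  | empty => simp
  | @insert e E heE ih =>
    rw [Finset.sum_powerset_insert heE, Finset.sum_powerset_insert heE, Finset.sum_powerset_insert heE, Finset.sum_powerset_insert heE]
    have hF1 : Monotone (fun ω : Finset ι => F (insert e ω)) := fun s t hst => hF (Finset.insert_subset_insert e hst)
    have hG1 : Monotone (fun ω : Finset ι => G (insert e ω)) := fun s t hst => hG (Finset.insert_subset_insert e hst)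
    have i0 := ih F G hF hG
    have i1 := ih (fun ω => F (insert e ω)) (fun ω => G (insert e ω)) hF1 hG1
    have hA : ∑ ω ∈ E.powerset, F ω ≤ ∑ ω ∈ E.powerset, F (insert e ω) :=
      Finset.sum_le_sum fun ω _ => hF (Finset.subset_insert e ω)
    have hB : ∑ ω ∈ E.powerset, G ω ≤ ∑ ω ∈ E.powerset, G (insert e ω) :=
      Finset.sum_le_sum fun ω _ => hG (Finset.subset_insert e ω)
    have hN : 0 ≤ ∑ _ω ∈ E.powerset, (1 : ℝ) := Finset.sum_nonneg fun _ _ => zero_le_one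
    set A0 := ∑ ω ∈ E.powerset, F ω
    set A1 := ∑ ω ∈ E.powerset, F (insert e ω)
    set B0 := ∑ ω ∈ E.powerset, G ω
    set B1 := ∑ ω ∈ E.powerset, G (insert e ω)
    set N := ∑ _ω ∈ E.powerset, (1 : ℝ)
    set S0 := ∑ ω ∈ E.powerset, F ω * G ω
    set S1 := ∑ ω ∈ E.powerset, F (insert e ω) * G (insert e ω)
    have key : (A0 + A1) * (B0 + B1) ≤ 2 * (A0 * B0 + A1 * B1) := by
      nlinarith [mul_nonneg (sub_nonneg.mpr hA) (sub_nonneg.mpr hB)]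
    have step : A0 * B0 + A1 * B1 ≤ N * S0 + N * S1 := add_le_add i0 i1
    nlinarith [key, step, hN]

open Classical in
/-- **The full anti-sum is free.**  For every finite multigraph (`ends`, edge set `E`), vertices `a, b`, monotone `h, k` and monotone levels
`0 ≤ hᵃ, hᵇ ≤ h`, `0 ≤ kᵃ, kᵇ ≤ k`:
`0 ≤ Σ_{ω ⊆ E} h(C_a ω ∪ C_b ω)k(C_a ω ∪ C_b ω) + Σ_{ω ⊆ E} (hᵃ(C_a ω) − hᵇ(C_b(E∖ω)))(kᵃ(C_a ω) − kᵇ(C_b(E∖ω)))` — the anti-sum over ALL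
colourings (no wall).  Proof: both factors are increasing in `ω`; Chebyshev gives `N·Σ FG ≥ (ΣF)(ΣG)`, and `|ΣF| = |Σ hᵃ(C_a ω) − Σ hᵇ(C_b ω)| ≤ Σ h(S)`,
`|ΣG| ≤ Σ k(S)`, `(Σ h(S))(Σ k(S)) ≤ N·Σ h(S)k(S)` (Chebyshev again). [cite: KozmaNitzan2024, Questions 8–9 (§5.5 p. 36) (context)] -/
theorem coreClass_fullAnti (ends : ι → Sym2 V) (E : Finset ι) (a b : V) (h k ha hb ka kb : Set V → ℝ)
    (hh : Monotone h) (hk : Monotone k) (mha : Monotone ha) (mhb : Monotone hb) (mka : Monotone ka) (mkb : Monotone kb)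
    (ha0 : ∀ X, 0 ≤ ha X) (hah : ∀ X, ha X ≤ h X) (hb0 : ∀ X, 0 ≤ hb X) (hbh : ∀ X, hb X ≤ h X)
    (ka0 : ∀ X, 0 ≤ ka X) (kak : ∀ X, ka X ≤ k X) (kb0 : ∀ X, 0 ≤ kb X) (kbk : ∀ X, kb X ≤ k X) :
    0 ≤ (∑ ω ∈ E.powerset,
        h (openCluster (ends '' (↑ω : Set ι)) a ∪ openCluster (ends '' (↑ω : Set ι)) b) *
          k (openCluster (ends '' (↑ω : Set ι)) a ∪ openCluster (ends '' (↑ω : Set ι)) b))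
      + ∑ ω ∈ E.powerset,
        (ha (openCluster (ends '' (↑ω : Set ι)) a) - hb (openCluster (ends '' (↑(E \ ω) : Set ι)) b)) *
          (ka (openCluster (ends '' (↑ω : Set ι)) a) - kb (openCluster (ends '' (↑(E \ ω) : Set ι)) b)) := by
  set C : Finset ι → V → Set V := fun ω v => openCluster (ends '' (↑ω : Set ι)) v with hC
  change 0 ≤ (∑ ω ∈ E.powerset, h (C ω a ∪ C ω b) * k (C ω a ∪ C ω b))
      + ∑ ω ∈ E.powerset, (ha (C ω a) - hb (C (E \ ω) b)) * (ka (C ω a) - kb (C (E \ ω) b))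
  have hCmono : ∀ {ω ω' : Finset ι} (v : V), ω ⊆ ω' → C ω v ⊆ C ω' v := fun v hle => openCluster_image_mono ends hle v
  -- the two factors and the supply functions are monotone in ω
  set F : Finset ι → ℝ := fun ω => ha (C ω a) - hb (C (E \ ω) b) with hF
  set G : Finset ι → ℝ := fun ω => ka (C ω a) - kb (C (E \ ω) b) with hG
  set Sh : Finset ι → ℝ := fun ω => h (C ω a ∪ C ω b) with hSh
  set Sk : Finset ι → ℝ := fun ω => k (C ω a ∪ C ω b) with hSk
  have mF : Monotone F := by
    intro s t hst
    have h1 : ha (C s a) ≤ ha (C t a) := mha (hCmono a hst)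
    have h2 : hb (C (E \ t) b) ≤ hb (C (E \ s) b) := mhb (hCmono b (Finset.sdiff_subset_sdiff (le_refl E) hst))
    simp only [hF]; linarith
  have mG : Monotone G := by
    intro s t hst
    have h1 : ka (C s a) ≤ ka (C t a) := mka (hCmono a hst)
    have h2 : kb (C (E \ t) b) ≤ kb (C (E \ s) b) := mkb (hCmono b (Finset.sdiff_subset_sdiff (le_refl E) hst))
    simp only [hG]; linarith
  have mSh : Monotone Sh := fun s t hst => hh (Set.union_subset_union (hCmono a hst) (hCmono b hst))
  have mSk : Monotone Sk := fun s t hst => hk (Set.union_subset_union (hCmono a hst) (hCmono b hst))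
  have cheb1 := sum_mul_sum_le_sum_one_mul_sum E F G mF mG
  have cheb2 := sum_mul_sum_le_sum_one_mul_sum E Sh Sk mSh mSk
  set N := ∑ _ω ∈ E.powerset, (1 : ℝ) with hN
  have hN1 : 1 ≤ N := by
    have hNe : N = (2 : ℝ) ^ E.card := by simp [hN]
    rw [hNe]; exact one_le_pow₀ (by norm_num)
  -- bounds on Σ F, Σ G through the swap ω ↦ E ∖ ω
  have swapb : ∑ ω ∈ E.powerset, hb (C (E \ ω) b) = ∑ ω ∈ E.powerset, hb (C ω b) := sum_powerset_sdiff E (fun ω => hb (C ω b))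
  have swapb' : ∑ ω ∈ E.powerset, kb (C (E \ ω) b) = ∑ ω ∈ E.powerset, kb (C ω b) := sum_powerset_sdiff E (fun ω => kb (C ω b))
  have hFsum : ∑ ω ∈ E.powerset, F ω = ∑ ω ∈ E.powerset, ha (C ω a) - ∑ ω ∈ E.powerset, hb (C ω b) := by
    simp only [hF, Finset.sum_sub_distrib, swapb]
  have hGsum : ∑ ω ∈ E.powerset, G ω = ∑ ω ∈ E.powerset, ka (C ω a) - ∑ ω ∈ E.powerset, kb (C ω b) := by
    simp only [hG, Finset.sum_sub_distrib, swapb']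
  have hA1 : 0 ≤ ∑ ω ∈ E.powerset, ha (C ω a) := Finset.sum_nonneg fun ω _ => ha0 _
  have hA2 : ∑ ω ∈ E.powerset, ha (C ω a) ≤ ∑ ω ∈ E.powerset, Sh ω :=
    Finset.sum_le_sum fun ω _ => le_trans (hah _) (hh Set.subset_union_left)
  have hB1 : 0 ≤ ∑ ω ∈ E.powerset, hb (C ω b) := Finset.sum_nonneg fun ω _ => hb0 _
  have hB2 : ∑ ω ∈ E.powerset, hb (C ω b) ≤ ∑ ω ∈ E.powerset, Sh ω :=
    Finset.sum_le_sum fun ω _ => le_trans (hbh _) (hh Set.subset_union_right)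
  have hA1' : 0 ≤ ∑ ω ∈ E.powerset, ka (C ω a) := Finset.sum_nonneg fun ω _ => ka0 _
  have hA2' : ∑ ω ∈ E.powerset, ka (C ω a) ≤ ∑ ω ∈ E.powerset, Sk ω :=
    Finset.sum_le_sum fun ω _ => le_trans (kak _) (hk Set.subset_union_left)
  have hB1' : 0 ≤ ∑ ω ∈ E.powerset, kb (C ω b) := Finset.sum_nonneg fun ω _ => kb0 _
  have hB2' : ∑ ω ∈ E.powerset, kb (C ω b) ≤ ∑ ω ∈ E.powerset, Sk ω :=
    Finset.sum_le_sum fun ω _ => le_trans (kbk _) (hk Set.subset_union_right)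
  set SF := ∑ ω ∈ E.powerset, F ω
  set SG := ∑ ω ∈ E.powerset, G ω
  set SSh := ∑ ω ∈ E.powerset, Sh ω
  set SSk := ∑ ω ∈ E.powerset, Sk ω
  have hF_abs1 : SF ≤ SSh := by rw [hFsum]; linarith
  have hF_abs2 : -SSh ≤ SF := by rw [hFsum]; linarith
  have hG_abs1 : SG ≤ SSk := by rw [hGsum]; linarith
  have hG_abs2 : -SSk ≤ SG := by rw [hGsum]; linarith
  -- SF·SG ≥ −SSh·SSk
  have prod_ge : -(SSh * SSk) ≤ SF * SG := by
    nlinarith [mul_nonneg (sub_nonneg.mpr hF_abs1) (sub_nonneg.mpr hG_abs2), mul_nonneg (sub_nonneg.mpr hF_abs2) (sub_nonneg.mpr hG_abs1),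
      mul_nonneg (sub_nonneg.mpr hF_abs1) (sub_nonneg.mpr hG_abs1), mul_nonneg (sub_nonneg.mpr hF_abs2) (sub_nonneg.mpr hG_abs2)]
  -- assemble: N (Σ ShSk + Σ FG) ≥ SSh SSk + SF SG ≥ 0
  have hmain : 0 ≤ N * ((∑ ω ∈ E.powerset, Sh ω * Sk ω) + ∑ ω ∈ E.powerset, F ω * G ω) := by nlinarith [cheb1, cheb2, prod_ge]
  have hNpos : 0 < N := lt_of_lt_of_le zero_lt_one hN1
  have := (mul_nonneg_iff_of_pos_left hNpos).mp hmain
  simpa [hSh, hSk, hF, hG] using this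


/-! ### The bridge cells (abstract form)

Throughout: `P₁ ω₁ = C_a(ω₁)`, `X₁ ω₁ = C_{c₁}(ω₁)` on `E₁`; `X₂ ω₂ = C_{c₂}(ω₂)`, `R₂ ω₂ = C_b(ω₂)` on `E₂`; red route in the side `E₁`:
`c₁ ∈ P₁ ω₁`; blue route: `c₁ ∈ P₁ (E₁∖ω₁)`; on the side `E₂`: `b ∈ X₂ ω₂` resp. `c₂ ∈ R₂ (E₂∖ω₂)`.  The clusters of the bridge graph `H` (proved in
`…KernelMixBridge`):  `e` red: `C_a = P₁ ∪ {y | c₁ ∈ P₁ ∧ y ∈ insert c₁ X₂}`, `C_b = R₂ ∪ {y | c₂ ∈ R₂ ∧ y ∈ insert c₂ X₁}`, `C_b(H∖ω) = R₂(E₂∖ω₂)`;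
`e` blue: `C_a = P₁`, `C_b = R₂`, `C_b(H∖ω) = R₂(E₂∖ω₂) ∪ {y | c₂ ∈ R₂(E₂∖ω₂) ∧ y ∈ insert c₂ (X₁(E₁∖ω₁))}`. -/

open Classical in
/-- **Bridge cell D1** (`e` red, no red route in `E₁`): the wall terms `(hᵃ(P₁) − hᵇ(Q₂))(kᵃ(P₁) − kᵇ(Q₂))` over ALL `ω₂` are paid termwise by the `e`-blue
supply `h(P₁ ∪ C_b)k(P₁ ∪ C_b)` at the swapped colouring of `E₂`. [cite: KozmaNitzan2024, Questions 8–9 (§5.5 p. 36) (context)] -/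
theorem bridgeCell_D1 (E₂ : Finset ι) (P : Set V) (R₂ : Finset ι → Set V) (h k ha hb ka kb : Set V → ℝ) (hh : Monotone h) (hk : Monotone k)
    (ha0 : ∀ X, 0 ≤ ha X) (hah : ∀ X, ha X ≤ h X) (hb0 : ∀ X, 0 ≤ hb X) (hbh : ∀ X, hb X ≤ h X)
    (ka0 : ∀ X, 0 ≤ ka X) (kak : ∀ X, ka X ≤ k X) (kb0 : ∀ X, 0 ≤ kb X) (kbk : ∀ X, kb X ≤ k X) :
    0 ≤ ∑ ω₂ ∈ E₂.powerset, (h (P ∪ R₂ ω₂) * k (P ∪ R₂ ω₂) + (ha P - hb (R₂ (E₂ \ ω₂))) * (ka P - kb (R₂ (E₂ \ ω₂)))) := by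
  have hsw : ∑ ω₂ ∈ E₂.powerset, h (P ∪ R₂ ω₂) * k (P ∪ R₂ ω₂) = ∑ ω₂ ∈ E₂.powerset, h (P ∪ R₂ (E₂ \ ω₂)) * k (P ∪ R₂ (E₂ \ ω₂)) :=
    (sum_powerset_sdiff E₂ (fun ω₂ => h (P ∪ R₂ ω₂) * k (P ∪ R₂ ω₂))).symm
  rw [Finset.sum_add_distrib, hsw, ← Finset.sum_add_distrib]
  refine Finset.sum_nonneg fun ω₂ _ => ?_
  exact mul_add_sub_mul_sub_nonneg (ha0 _) (le_trans (hah _) (hh Set.subset_union_left)) (hb0 _) (le_trans (hbh _) (hh Set.subset_union_right))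
    (ka0 _) (le_trans (kak _) (hk Set.subset_union_left)) (kb0 _) (le_trans (kbk _) (hk Set.subset_union_right))

open Classical in
/-- **Bridge cell D3** (`e` blue, no blue route in `E₂`): the wall terms `(hᵃ(P₁) − hᵇ(Q₂))(kᵃ(P₁) − kᵇ(Q₂))` on `{c₂ ∉ R₂(E₂∖ω₂)}` are paid termwise by any
supply family `Y(ω₂) ⊇ P₁ ∪ R₂(ω₂)` at the swapped colouring. [cite: KozmaNitzan2024, Questions 8–9 (§5.5 p. 36) (context)] -/
theorem bridgeCell_D3 (E₂ : Finset ι) (c₂ : V) (P : Set V) (R₂ Y : Finset ι → Set V) (hY : ∀ ω₂, ω₂ ⊆ E₂ → P ∪ R₂ ω₂ ⊆ Y ω₂)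
    (h k ha hb ka kb : Set V → ℝ) (hh : Monotone h) (hk : Monotone k)
    (ha0 : ∀ X, 0 ≤ ha X) (hah : ∀ X, ha X ≤ h X) (hb0 : ∀ X, 0 ≤ hb X) (hbh : ∀ X, hb X ≤ h X)
    (ka0 : ∀ X, 0 ≤ ka X) (kak : ∀ X, ka X ≤ k X) (kb0 : ∀ X, 0 ≤ kb X) (kbk : ∀ X, kb X ≤ k X) :
    0 ≤ ∑ ω₂ ∈ E₂.powerset, ((if c₂ ∉ R₂ (E₂ \ ω₂) then h (Y (E₂ \ ω₂)) * k (Y (E₂ \ ω₂)) else 0)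
      + (if c₂ ∉ R₂ (E₂ \ ω₂) then (ha P - hb (R₂ (E₂ \ ω₂))) * (ka P - kb (R₂ (E₂ \ ω₂))) else 0)) := by
  have hh0 : ∀ X, 0 ≤ h X := fun X => le_trans (ha0 X) (hah X)
  have hk0 : ∀ X, 0 ≤ k X := fun X => le_trans (ka0 X) (kak X)
  refine Finset.sum_nonneg fun ω₂ hω₂ => ?_
  by_cases hc : c₂ ∉ R₂ (E₂ \ ω₂)
  · rw [if_pos hc, if_pos hc]
    have hsub : P ∪ R₂ (E₂ \ ω₂) ⊆ Y (E₂ \ ω₂) := hY (E₂ \ ω₂) Finset.sdiff_subset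
    exact mul_add_sub_mul_sub_nonneg (ha0 _) (le_trans (hah _) (hh (le_trans Set.subset_union_left hsub)))
      (hb0 _) (le_trans (hbh _) (hh (le_trans Set.subset_union_right hsub)))
      (ka0 _) (le_trans (kak _) (hk (le_trans Set.subset_union_left hsub))) (kb0 _) (le_trans (kbk _) (hk (le_trans Set.subset_union_right hsub)))
  · rw [if_neg hc, if_neg hc]; simp

open Classical in
/-- **Bridge cell D2** (`e` red, red route in `E₁`, i.e. `c₁ ∈ P₁ = A`): the wall terms over `{b ∉ X₂ ω₂}` with `P = A ∪ X₂ ω₂` are an instance of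
ONE-SIDED(E₂; c₂, b) glued by `A`, paid by any supply family `Y(ω₂) ⊇ A ∪ X₂ ω₂ ∪ R₂ ω₂`. [cite: KozmaNitzan2024, Questions 8–9 (§5.5 p. 36) (context)] -/
theorem bridgeCell_D2 (E₂ : Finset ι) (b : V) (A : Set V) (X₂ R₂ Y : Finset ι → Set V) (hY : ∀ ω₂, ω₂ ⊆ E₂ → A ∪ (X₂ ω₂ ∪ R₂ ω₂) ⊆ Y ω₂)
    (h k ha hb ka kb : Set V → ℝ) (hh : Monotone h) (hk : Monotone k) (ka0 : ∀ X, 0 ≤ ka X) (kak : ∀ X, ka X ≤ k X) (ha0 : ∀ X, 0 ≤ ha X) (hah : ∀ X, ha X ≤ h X)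
    (hOS₂ : 0 ≤ (∑ ω₂ ∈ E₂.powerset, h (A ∪ (X₂ ω₂ ∪ R₂ ω₂)) * k (A ∪ (X₂ ω₂ ∪ R₂ ω₂)))
      + ∑ ω₂ ∈ E₂.powerset.filter (fun ω₂ => b ∉ X₂ ω₂), (ha (A ∪ X₂ ω₂) - hb (R₂ (E₂ \ ω₂))) * (ka (A ∪ X₂ ω₂) - kb (R₂ (E₂ \ ω₂)))) :
    0 ≤ ∑ ω₂ ∈ E₂.powerset, (h (Y ω₂) * k (Y ω₂)
      + (if b ∉ X₂ ω₂ then (ha (A ∪ X₂ ω₂) - hb (R₂ (E₂ \ ω₂))) * (ka (A ∪ X₂ ω₂) - kb (R₂ (E₂ \ ω₂))) else 0)) := by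
  have hh0 : ∀ X, 0 ≤ h X := fun X => le_trans (ha0 X) (hah X)
  have hk0 : ∀ X, 0 ≤ k X := fun X => le_trans (ka0 X) (kak X)
  rw [Finset.sum_filter] at hOS₂
  rw [Finset.sum_add_distrib]
  have hsup : ∑ ω₂ ∈ E₂.powerset, h (A ∪ (X₂ ω₂ ∪ R₂ ω₂)) * k (A ∪ (X₂ ω₂ ∪ R₂ ω₂)) ≤ ∑ ω₂ ∈ E₂.powerset, h (Y ω₂) * k (Y ω₂) :=
    Finset.sum_le_sum fun ω₂ hω₂ =>
      mul_le_mul (hh (hY ω₂ (Finset.mem_powerset.mp hω₂))) (hk (hY ω₂ (Finset.mem_powerset.mp hω₂))) (hk0 _) (hh0 _)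
  linarith

open Classical in
/-- **Bridge cell D2 ∪ (red-route cell)** (`e` red, `c₁ ∈ P₁ = A`, ALL `ω₂`): paid by the free full anti-sum of `E₂` glued by `A` (THEOREM B needs no
hypothesis on `E₂`). [cite: KozmaNitzan2024, Questions 8–9 (§5.5 p. 36) (context)] -/
theorem bridgeCell_D2_full (E₂ : Finset ι) (A : Set V) (X₂ R₂ Y : Finset ι → Set V) (hY : ∀ ω₂, ω₂ ⊆ E₂ → A ∪ (X₂ ω₂ ∪ R₂ ω₂) ⊆ Y ω₂)
    (h k ha hb ka kb : Set V → ℝ) (hh : Monotone h) (hk : Monotone k) (ka0 : ∀ X, 0 ≤ ka X) (kak : ∀ X, ka X ≤ k X) (ha0 : ∀ X, 0 ≤ ha X) (hah : ∀ X, ha X ≤ h X)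
    (hFA₂ : 0 ≤ (∑ ω₂ ∈ E₂.powerset, h (A ∪ (X₂ ω₂ ∪ R₂ ω₂)) * k (A ∪ (X₂ ω₂ ∪ R₂ ω₂)))
      + ∑ ω₂ ∈ E₂.powerset, (ha (A ∪ X₂ ω₂) - hb (R₂ (E₂ \ ω₂))) * (ka (A ∪ X₂ ω₂) - kb (R₂ (E₂ \ ω₂)))) :
    0 ≤ ∑ ω₂ ∈ E₂.powerset, (h (Y ω₂) * k (Y ω₂) + (ha (A ∪ X₂ ω₂) - hb (R₂ (E₂ \ ω₂))) * (ka (A ∪ X₂ ω₂) - kb (R₂ (E₂ \ ω₂)))) := by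
  have hh0 : ∀ X, 0 ≤ h X := fun X => le_trans (ha0 X) (hah X)
  have hk0 : ∀ X, 0 ≤ k X := fun X => le_trans (ka0 X) (kak X)
  rw [Finset.sum_add_distrib]
  have hsup : ∑ ω₂ ∈ E₂.powerset, h (A ∪ (X₂ ω₂ ∪ R₂ ω₂)) * k (A ∪ (X₂ ω₂ ∪ R₂ ω₂)) ≤ ∑ ω₂ ∈ E₂.powerset, h (Y ω₂) * k (Y ω₂) :=
    Finset.sum_le_sum fun ω₂ hω₂ =>
      mul_le_mul (hh (hY ω₂ (Finset.mem_powerset.mp hω₂))) (hk (hY ω₂ (Finset.mem_powerset.mp hω₂))) (hk0 _) (hh0 _)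
  linarith

open Classical in
/-- **Bridge cell D4** (`e` blue, blue route in `E₂`, i.e. `c₂ ∈ Q₂ = B`): the wall terms `(hᵃ(P₁ ω₁) − hᵇ(B ∪ X₁(E₁∖ω₁)))(…)` over `{c₁ ∉ P₁(E₁∖ω₁)}`
are, after `ω₁ ↦ E₁∖ω₁`, an instance of ONE-SIDED(E₁; c₁, a) with `c₁`-levels `hᵇ(B ∪ ·)` and `a`-levels `hᵃ`, paid by any supply family
`Y(ω₁) ⊇ B ∪ X₁ ω₁ ∪ P₁ ω₁`. [cite: KozmaNitzan2024, Questions 8–9 (§5.5 p. 36) (context)] -/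
theorem bridgeCell_D4 (E₁ : Finset ι) (c₁ a : V) (B : Set V) (P₁ X₁ Y : Finset ι → Set V) (hcomm : ∀ ω₁, ω₁ ⊆ E₁ → (a ∈ X₁ ω₁ ↔ c₁ ∈ P₁ ω₁))
    (hY : ∀ ω₁, ω₁ ⊆ E₁ → B ∪ (X₁ ω₁ ∪ P₁ ω₁) ⊆ Y ω₁)
    (h k ha hb ka kb : Set V → ℝ) (hh : Monotone h) (hk : Monotone k) (ka0 : ∀ X, 0 ≤ ka X) (kak : ∀ X, ka X ≤ k X) (ha0 : ∀ X, 0 ≤ ha X) (hah : ∀ X, ha X ≤ h X)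
    (hOS₁ : 0 ≤ (∑ ω₁ ∈ E₁.powerset, h (B ∪ (X₁ ω₁ ∪ P₁ ω₁)) * k (B ∪ (X₁ ω₁ ∪ P₁ ω₁)))
      + ∑ ω₁ ∈ E₁.powerset.filter (fun ω₁ => a ∉ X₁ ω₁), (hb (B ∪ X₁ ω₁) - ha (P₁ (E₁ \ ω₁))) * (kb (B ∪ X₁ ω₁) - ka (P₁ (E₁ \ ω₁)))) :
    0 ≤ ∑ ω₁ ∈ E₁.powerset, (h (Y ω₁) * k (Y ω₁)
      + (if c₁ ∉ P₁ (E₁ \ ω₁) then (ha (P₁ ω₁) - hb (B ∪ X₁ (E₁ \ ω₁))) * (ka (P₁ ω₁) - kb (B ∪ X₁ (E₁ \ ω₁))) else 0)) := by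
  have hh0 : ∀ X, 0 ≤ h X := fun X => le_trans (ha0 X) (hah X)
  have hk0 : ∀ X, 0 ≤ k X := fun X => le_trans (ka0 X) (kak X)
  rw [Finset.sum_filter] at hOS₁
  -- reindex the anti-sum of the hypothesis by the swap ω₁ ↦ E₁ ∖ ω₁
  have hre : ∑ ω₁ ∈ E₁.powerset, (if a ∉ X₁ ω₁ then (hb (B ∪ X₁ ω₁) - ha (P₁ (E₁ \ ω₁))) * (kb (B ∪ X₁ ω₁) - ka (P₁ (E₁ \ ω₁))) else 0)
      = ∑ ω₁ ∈ E₁.powerset, (if c₁ ∉ P₁ (E₁ \ ω₁) then (ha (P₁ ω₁) - hb (B ∪ X₁ (E₁ \ ω₁))) * (ka (P₁ ω₁) - kb (B ∪ X₁ (E₁ \ ω₁))) else 0) := by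
    rw [← sum_powerset_sdiff E₁ (fun ω₁ => if a ∉ X₁ ω₁ then (hb (B ∪ X₁ ω₁) - ha (P₁ (E₁ \ ω₁))) * (kb (B ∪ X₁ ω₁) - ka (P₁ (E₁ \ ω₁))) else 0)]
    refine Finset.sum_congr rfl fun ω₁ hω₁ => ?_
    have hω₁ := Finset.mem_powerset.mp hω₁
    rw [Finset.sdiff_sdiff_eq_self hω₁]
    have hiff : a ∉ X₁ (E₁ \ ω₁) ↔ c₁ ∉ P₁ (E₁ \ ω₁) := not_congr (hcomm (E₁ \ ω₁) Finset.sdiff_subset)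
    by_cases hc : c₁ ∉ P₁ (E₁ \ ω₁)
    · rw [if_pos (hiff.mpr hc), if_pos hc]; ring
    · rw [if_neg (fun hx => hc (hiff.mp hx)), if_neg hc]
  rw [hre] at hOS₁
  rw [Finset.sum_add_distrib]
  have hsup : ∑ ω₁ ∈ E₁.powerset, h (B ∪ (X₁ ω₁ ∪ P₁ ω₁)) * k (B ∪ (X₁ ω₁ ∪ P₁ ω₁)) ≤ ∑ ω₁ ∈ E₁.powerset, h (Y ω₁) * k (Y ω₁) :=
    Finset.sum_le_sum fun ω₁ hω₁ =>
      mul_le_mul (hh (hY ω₁ (Finset.mem_powerset.mp hω₁))) (hk (hY ω₁ (Finset.mem_powerset.mp hω₁))) (hk0 _) (hh0 _)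
  linarith


end Coefficientwise

end Summit.CriticalPhenomena.PercolationContinuityZ3.Theorems
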